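import Summits.MatrixMultiplication.MatrixMultiplication.Theses.EPRFaces

/-!
# Route `EPRFaces`, item stmt-MatrixMultiplication-10896 `Converse` — `ω = 2 → B ∧ E`

Support item of route `EPRFaces` (rank form, rev 1): the factorisation `ω − 2 = e(∞) + d` loses
nothing, i.e. `MatrixMultiplication` (`ω(ℂ) = 2`) implies both

* **B** (face maximiser): for every `k ≥ 1` and every `β` with `R(⟨n,n,n^k⟩) = O(n^β)`,
  `ω + (k − 1) ≤ β`; and
* **E** (perfect amortisation): for every `ε > 0` some `k ≥ 1` has
  `R(⟨n,n,n^k⟩) = O(n^{k+1+ε})`.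

Proof.  B: the flattening bound `n · n^k ≤ R(⟨n,n,n^k⟩)` (`mul_le_tensorRank_matMulTensor`,
Bläser 2013, Lemma 7.1 (2)) reads `n^{k+1} ≤ R(⟨n,n,n^k⟩)`; if `R(⟨n,n,n^k⟩) ≤ C·n^β` eventually
with `β < k + 1`, then `n^{k+1-β} ≤ C` eventually, contradicting `n^{k+1-β} → ∞`; so `k + 1 ≤ β`,
and `ω = 2` turns `ω + (k − 1)` into `k + 1`.  E: take `k = 1`; `ω = inf admissibleExponents = 2`
gives an admissible `β < 2 + ε` (`exists_lt_of_csInf_lt`), hence `2 + ε` is admissible (upward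
closure `mem_admissibleExponents_of_le`), i.e. `R(⟨n,n,n⟩) = O(n^{2+ε})`, and `n^1 = n` reindexes
the tensor.
-/

-- `Summit.MatrixMultiplication.MatrixMultiplication.…` repeats a component by design (single-conjunct summit)
set_option linter.dupNamespace false

namespace Summit.MatrixMultiplication.MatrixMultiplication.Theorems

open Filter Asymptotics
open Literature.Computability.AlgebraicComplexity

namespace EPRFacesConverse

/-- Flattening in real-exponent form: `n^{k+1} ≤ R(⟨n,n,n^k⟩)` for `n ≥ 1`
(from `mul_le_tensorRank_matMulTensor`: `n · n^k ≤ R(⟨n,n,n^k⟩)`). -/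
theorem rpow_succ_le_tensorRank (k n : ℕ) (hn : 0 < n) :
    (n : ℝ) ^ ((k : ℝ) + 1) ≤ (tensorRank (matMulTensor ℂ n n (n ^ k)) : ℝ) := by
  haveI : NeZero n := ⟨hn.ne'⟩
  have h := mul_le_tensorRank_matMulTensor ℂ n n (n ^ k)
  have hcast : ((n * n ^ k : ℕ) : ℝ) ≤ (tensorRank (matMulTensor ℂ n n (n ^ k)) : ℝ) := by
    exact_mod_cast h
  have heq : (n : ℝ) ^ ((k : ℝ) + 1) = ((n * n ^ k : ℕ) : ℝ) := by
    have hk : ((k : ℝ) + 1) = ((k + 1 : ℕ) : ℝ) := by norm_cast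
    rw [hk, Real.rpow_natCast]
    push_cast
    ring
  rw [heq]
  exact hcast

/-- Exponent comparison: an `O(n^β)` bound on `R(⟨n,n,n^k⟩)` forces `k + 1 ≤ β`
(flattening `n^{k+1} ≤ R(⟨n,n,n^k⟩)` against `n^{k+1-β} → ∞`). -/
theorem succ_le_of_isBigO (k : ℕ) {β : ℝ}
    (hO : (fun n : ℕ => (tensorRank (matMulTensor ℂ n n (n ^ k)) : ℝ)) =O[atTop]
      fun n : ℕ => (n : ℝ) ^ β) :
    (k : ℝ) + 1 ≤ β := by
  by_contra hlt
  rw [not_le] at hlt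
  obtain ⟨C, hC⟩ := isBigO_iff.1 hO
  -- eventually `n ^ (k + 1 - β) ≤ C`
  have hev : ∀ᶠ n : ℕ in atTop, (n : ℝ) ^ ((k : ℝ) + 1 - β) ≤ C := by
    filter_upwards [hC, eventually_gt_atTop 0] with n hn hn0
    have hn0' : (0 : ℝ) < n := Nat.cast_pos.2 hn0
    rw [Real.norm_of_nonneg (Nat.cast_nonneg _),
      Real.norm_of_nonneg (Real.rpow_nonneg (Nat.cast_nonneg _) _)] at hn
    have hle : (n : ℝ) ^ ((k : ℝ) + 1) ≤ C * (n : ℝ) ^ β :=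
      (rpow_succ_le_tensorRank k n hn0).trans hn
    rw [Real.rpow_sub hn0', div_le_iff₀ (Real.rpow_pos_of_pos hn0' _)]
    exact hle
  -- but `n ^ (k + 1 - β) → ∞`
  have hlim : Tendsto (fun n : ℕ => (n : ℝ) ^ ((k : ℝ) + 1 - β)) atTop atTop :=
    (tendsto_rpow_atTop (by linarith)).comp tendsto_natCast_atTop_atTop
  obtain ⟨n, hn₁, hn₂⟩ := (hev.and (hlim.eventually_gt_atTop C)).exists
  exact absurd hn₁ (not_le.2 hn₂)

/-- E at `k = 1` from `ω(ℂ) = 2`: for `ε > 0`, `R(⟨n,n,n^1⟩) = O(n^{1+1+ε})` — an admissible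
exponent `β < 2 + ε` exists (`exists_lt_of_csInf_lt`), `2 + ε` is then admissible by upward
closure, and `n^1 = n`. -/
theorem isBigO_two_add_of_omega_eq_two (hω : omega ℂ = 2) {ε : ℝ} (hε : 0 < ε) :
    (fun n : ℕ => (tensorRank (matMulTensor ℂ n n (n ^ 1)) : ℝ)) =O[atTop]
      fun n : ℕ => (n : ℝ) ^ (((1 : ℕ) : ℝ) + 1 + ε) := by
  have hlt : sInf (admissibleExponents ℂ) < 2 + ε := by
    show omega ℂ < 2 + ε
    rw [hω]
    linarith
  obtain ⟨β, hβ, hβlt⟩ := exists_lt_of_csInf_lt (admissibleExponents_nonempty ℂ) hlt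
  have hmem : (2 + ε) ∈ admissibleExponents ℂ := mem_admissibleExponents_of_le ℂ hβ hβlt.le
  have h2 : (((1 : ℕ) : ℝ) + 1 + ε) = 2 + ε := by norm_num
  have hfun : (fun n : ℕ => (tensorRank (matMulTensor ℂ n n (n ^ 1)) : ℝ)) =
      fun n : ℕ => (tensorRank (matMulTensor ℂ n n n) : ℝ) := by
    funext n
    rw [pow_one]
  rw [h2, hfun]
  exact hmem

end EPRFacesConverse

open EPRFacesConverse in
/-- **Converse** (route `EPRFaces`, item stmt-MatrixMultiplication-10896): `ω(ℂ) = 2` implies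
B ∧ E in rank form — (B) for every `k ≥ 1`, every `β` with `R(⟨n,n,n^k⟩) = O(n^β)` satisfies
`ω + (k − 1) ≤ β` (flattening `n^{k+1} ≤ R(⟨n,n,n^k⟩)` gives `k + 1 ≤ β`, and `ω = 2`);
(E) for every `ε > 0`, `k = 1` works: `R(⟨n,n,n⟩) = O(n^{2+ε})` because `2 = ω` is the infimum
of the admissible exponents, which are upward closed. -/
theorem converse_proof :
    Summit.MatrixMultiplication.MatrixMultiplication.Theses.EPRFaces.Converse := by
  unfold Summit.MatrixMultiplication.MatrixMultiplication.Theses.EPRFaces.Converse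
  intro hMM
  have hω : omega ℂ = 2 := (_root_.MatrixMultiplication_iff).1 hMM
  refine ⟨fun k _hk β hO => ?_, fun ε hε => ⟨1, le_rfl, isBigO_two_add_of_omega_eq_two hω hε⟩⟩
  have h := succ_le_of_isBigO k hO
  rw [hω]
  linarith

end Summit.MatrixMultiplication.MatrixMultiplication.Theorems
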